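import Summits.QuantumFields.YangMills.Theorems.BalabanUVNodesN18AvgPotentialLogChart
import Summits.QuantumFields.YangMills.Theorems.BalabanUVNodesN18ExpRemainderLipschitz
import Summits.QuantumFields.YangMills.Theorems.UnitScaleTiltProp8ChartDeriv

/-!
# BalabanUVNodes ∕ node N18 = NE5 — closure-ledger item (iii), (β3b) second file: THE CHART-IN EDITION `U = exp(iξA)` OF PROP. 3 IN THE LOGARITHMIC CHART —
# the letters of the comb-corrected averaged potential `log Ū(c) + iξ·(λ̄_A(c₊) − λ̄_A(c₋)) = i(Lξ)·(QA)(c) + P̃_c(A)` IN TERMS OF THE FINE POTENTIAL `A`: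
# `‖P̃_c(A)‖ ≤ 607·ℓ²ξ²r²` (C⁰), `‖P̃_c(A) − P̃_c(A′)‖ ≤ 1166·ℓ²ξ²r·sup‖A − A′‖` (C¹), coarse unit differences `≤ 1166·ℓ²ξ²r·(L·r₁)`; hence
# `|Ā|`-letter `≤ Lξ·|A|_feed + 607ℓ²ξ²r²` and `|ΔĀ|`-letter `≤ Lξ·L·r₁·(1 + 1166·(d+2)²·L·ξr)` — print's (1.12) transport with relative slack `O(d²L·ξ·α₀)`, single bar
# (Track A, DAG node N18 = `T4OutputRate.NE5` :211; cluster K4 «SpineRates», item K3⁷ `SpineGivenEndpointR13SepCoPH`; WIDTH SEAT pub-ymgap-dag-n18-w3 g2, file 2)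

HONEST FRAMING.  Count-neutral kernel bookkeeping (`--supports stmt-QuantumFields-20544 --as helper`); elementary, PROVED: file 1 (`…N18AvgPotentialLogChart`: the
potential remainder `P_c(U) = log Ū(c) − (Q₁Y)(c)`, C⁰ `151(ℓδ)²`, C¹ `290ℓ²δε`, coarse differences) read through the bond-variable chart `Y_b = U_b − 1 = iξA_b + E_b` with
dag-n18-d's module 27 (`norm_expRem_smul_sub_le_linear`: the chart remainder `E` is Lipschitz in `A` with constant `2ξ²r`) and the exponential letters of
`B7TransferAnalyticMean` ∕ `Literature.Analysis.Complex` (`‖e^X − 1‖ ≤ 2‖X‖`, `‖e^X − 1 − X‖ ≤ e^{‖X‖} − 1 − ‖X‖`, `‖e^X − e^Y‖ ≤ ‖X − Y‖e^{max}`).  NE5 is NOT PRINTED and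
NOT proved; N18 is NOT discharged; the transport clause `hT₀`∕`hTsp` is NOT discharged here.

WHY.  [Balaban1987RG1] (1.12) p.262 and [Balaban1985Averaging] Prop. 3 (121)–(123) p.36 are written in the potential `A` of `U = exp(iξA)` (`ξ = η_j` the lattice spacing),
and the transported letters are those of `Ā = (iξ′)⁻¹ log Ū`, `ξ′ = Lξ`.  File 1 proved Prop. 3 in the log chart with letters in the bond variables `Y = U − 1`; this file
substitutes the chart: `Q₁Y = iξ·Q₁A + Q₁E` (`Prop7AvgLinearisation.linAvg_sub`, `Prop8Chart.linAvg_const_smul`), `‖E_b‖ ≤ (ξr)²`, so the potential remainder in `A`-letters `P̃_c(A) := log Ū(c) − iξ·(Q₁A)(c)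
= P_c(U) + (Q₁E)(c)` is again second order, Lipschitz with the smallness factor, with second-order coarse differences; and `iξ·Q₁A = i(Lξ)·QA − iξ·dλ̄_A`
(`linAvg_eq_bondAvg_sub_grad_combMean`) displays the main term `ξ′·(QA)(c)` — KING'S K-ROW (dag-n18-d 19a) then gives the SUP letter `|Ā + dλ̄_A∕L| ≤ |A|_feed + O(ℓ²ξr²∕L)`
and the COARSE-DIFFERENCE letter `|Δ_ν(Ā + dλ̄_A∕L)| ≤ L·r₁·(1 + 1166(d+2)²·L·ξr)`, i.e. `|∇^{ξ′}Ā…| ≤ |∇^ξA|·(1 + O(d²L·ξ·α₀))` — the spec's (β5) with the comb term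
LINEARISED (single bar).  The nonlinear comb gauge `v = exp λ̄` ((β3) proper) and the `Sect2.CondI` packaging on the cubes of record remain the successor's.

WHAT (`U_b = exp((iξ)·A_b)` with `‖A_b‖ ≤ r`, `0 ≤ ξ`, `48ℓξr ≤ 1`, `4ℓξr < δ_N`; `ℓ = (d+2)L`; all objects as in file 1).
* §1 the chart letters (ℂ-homogeneity of `Q₁` is the tree's `Prop8Chart.linAvg_const_smul`, cited) `norm_expI_smul_sub_one_le` (`‖U_b − 1‖ ≤ 2ξr`),
  `norm_expI_smul_sub_one_sub_le` (`‖E_b‖ ≤ (ξr)²`), `norm_expI_smul_sub_expI_smul_le` (`‖U_b − U′_b‖ ≤ 2ξ‖A_b − A′_b‖`).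
* §2 `potRemA_eq` (`P̃_c(A) = P_c(U) + (Q₁E)(c)`), ★ `norm_potRemA_le` (C⁰ `≤ 607·ℓ²ξ²r²`), ★ `norm_potRemA_sub_potRemA_le` (C¹ `≤ 1166·ℓ²ξ²r·ρ`).
* §3 ★ `norm_potRemA_shift_sub_le` (coarse unit differences `≤ 1166·ℓ²ξ²r·(L·r₁)`, `r₁` = unit `ν`-differences of `A`).
* §4 ★ `mlog_avgFun_add_smul_grad_combMean_eq` (`log Ū(c) + iξ(λ̄_A(c₊) − λ̄_A(c₋)) = (iξL)·(QA)(c) + P̃_c(A)`), ★ `norm_mlog_avgFun_add_smul_grad_combMean_le` (SUP letter),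
  ★ `norm_shift_sub_mlog_avgFun_add_smul_grad_combMean_le` (COARSE-DIFFERENCE letter).

WHAT THIS IS NOT.  Not the double-bar (comb-gauge-fixed) edition; not local (two-block) hypotheses; not `Sect2.CondI`; not (T1)–(T3) of module 21; finite tori at fixed
`ε` — not continuum ∕ OS ∕ mass gap ∕ Clay.  0 `def`, 0 `sorry`, standard axioms.

v1.0.1 (docstring-only re-cite, same seat∕generation; every declaration byte-identical below its docstring): the `[King1986, Lemma 4.5 (4.38) p.674]` locator on the
two K-row letters of §4 is DROPPED (ref-N READ-24 NIT-CITE: (4.38) is King's propagator-convergence bound, not the block-average K-row); the K-row is cited BY NAME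
(dag-n18-d 19a `norm_bondAvg_le_of_forall_run` ∕ `norm_bondAvg_shift_sub_le_of_forall_run`).
-/

open scoped BigOperators

namespace YMDAG.N18.AvgPotential

open NormedSpace (exp)
open Literature.MathematicalPhysics.QuantumFieldTheory.Balaban1983to89
open Literature.MathematicalPhysics.QuantumFieldTheory.Balaban1983to89.T4Continuum
open Literature.MathematicalPhysics.QuantumFieldTheory.Balaban1983to89.BlockAveraging
open Literature.MathematicalPhysics.QuantumFieldTheory.Balaban1983to89.LatticeFieldCalculus (bondAvg runBond runSite)
open Literature.MathematicalPhysics.QuantumFieldTheory.Balaban1983to89.ExpMeanLog (deltaSU expMeanLogSU)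
open Literature.MathematicalPhysics.QuantumFieldTheory.Balaban1983to89.MatrixLog (mlog)
open Literature.MathematicalPhysics.QuantumFieldTheory.Balaban1983to89.BlockAveragingEMLLinearised (walkSum walkSum_cons walkSum_nil linAvg linAvg_def combMean
  linAvg_eq_bondAvg_sub_grad_combMean)
open Literature.MathematicalPhysics.QuantumFieldTheory.Balaban1983to89.B7TransferAnalyticMean (norm_exp_sub_one_le_two_mul norm_exp_sub_one_sub_self_le)
open Literature.Analysis.Complex (norm_exp_sub_exp_le)
open YMDAG.N18.HolonomyLipschitz (norm_expRem_smul_sub_le_linear norm_translate_nsmul_sub_le)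
open YMDAG.N18.CondIKRow (norm_bondAvg_le_of_forall_run norm_bondAvg_shift_sub_le_of_forall_run)
open Summit.QuantumFields.YangMills.Theorems.Prop7AvgLinearisation (linAvg_sub norm_linAvg_le)
open Summit.QuantumFields.YangMills.Theorems.Prop7LinAvgOnto (linAvg_add)
open Summit.QuantumFields.YangMills.Theorems.Prop8Chart (linAvg_const_smul)

open scoped Matrix.Norms.L2Operator

variable {n : Type*} [Fintype n] [DecidableEq n] [Nonempty n] {P : Params} {j : ℕ}

/-! ## §1 The chart letters -/

section Chart

/-- `‖iξ‖ = ξ` for real `ξ ≥ 0`. [folklore] -/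
private theorem norm_I_mul_ofReal {ξ : ℝ} (hξ : 0 ≤ ξ) : ‖(Complex.I * ξ : ℂ)‖ = ξ := by
  rw [norm_mul, Complex.norm_I, one_mul, Complex.norm_real, Real.norm_of_nonneg hξ]

omit [Nonempty n] in
/-- `‖iξA‖ ≤ ξr` for `‖A‖ ≤ r`. [folklore] -/
private theorem norm_smul_le_of_le {ξ : ℝ} (hξ : 0 ≤ ξ) {X : Matrix n n ℂ} {r : ℝ} (hX : ‖X‖ ≤ r) : ‖(Complex.I * ξ : ℂ) • X‖ ≤ ξ * r := by
  rw [norm_smul, norm_I_mul_ofReal hξ]; exact mul_le_mul_of_nonneg_left hX hξ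

omit [Nonempty n] in
/-- **THE BOND VARIABLE OF THE CHART IS FIRST ORDER**: `‖exp(iξA) − 1‖ ≤ 2ξr` for `‖A‖ ≤ r`, `ξr ≤ 1` (`B7TransferAnalyticMean.norm_exp_sub_one_le_two_mul`).
[cite: Balaban1987RG1, (1.12) p.262 (the chart `U = exp iξA`)] -/
theorem norm_expI_smul_sub_one_le {ξ : ℝ} (hξ : 0 ≤ ξ) {X : Matrix n n ℂ} {r : ℝ} (hX : ‖X‖ ≤ r) (hξr : ξ * r ≤ 1) :
    ‖exp ((Complex.I * ξ : ℂ) • X) - 1‖ ≤ 2 * (ξ * r) := by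
  have h1 := norm_smul_le_of_le hξ hX
  exact (norm_exp_sub_one_le_two_mul (h1.trans hξr)).trans (mul_le_mul_of_nonneg_left h1 (by norm_num))

omit [Nonempty n] in
/-- **THE CHART REMAINDER IS SECOND ORDER**: `‖exp(iξA) − 1 − iξA‖ ≤ (ξr)²` for `‖A‖ ≤ r`, `ξr ≤ 1` (`e^t − 1 − t ≤ t²` on `[0,1]`, Mathlib's
`Real.abs_exp_sub_one_sub_id_le`). [cite: Balaban1987RG1, (1.12) p.262 (the chart `U = exp iξA`)] -/
theorem norm_expI_smul_sub_one_sub_le {ξ : ℝ} (hξ : 0 ≤ ξ) {X : Matrix n n ℂ} {r : ℝ} (hX : ‖X‖ ≤ r) (hξr : ξ * r ≤ 1) :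
    ‖exp ((Complex.I * ξ : ℂ) • X) - 1 - (Complex.I * ξ : ℂ) • X‖ ≤ (ξ * r) ^ 2 := by
  set Z : Matrix n n ℂ := (Complex.I * ξ : ℂ) • X
  have hZ : ‖Z‖ ≤ ξ * r := norm_smul_le_of_le hξ hX
  have hZ1 : |‖Z‖| ≤ 1 := by rw [abs_of_nonneg (norm_nonneg _)]; exact hZ.trans hξr
  have h := norm_exp_sub_one_sub_self_le Z
  have hreal : Real.exp ‖Z‖ - 1 - ‖Z‖ ≤ ‖Z‖ ^ 2 := (le_abs_self _).trans (Real.abs_exp_sub_one_sub_id_le hZ1)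
  have hsq : ‖Z‖ ^ 2 ≤ (ξ * r) ^ 2 := pow_le_pow_left₀ (norm_nonneg _) hZ 2
  exact h.trans (hreal.trans hsq)

/-- **THE CHART IS LIPSCHITZ**: `‖exp(iξA) − exp(iξA′)‖ ≤ 2ξ‖A − A′‖` for `‖A‖, ‖A′‖ ≤ r`, `ξr ≤ 1∕2` (`Literature.Analysis.Complex.norm_exp_sub_exp_le`, `e^{1∕2} ≤ 2`).
[cite: Balaban1987RG1, (1.12) p.262 (the chart `U = exp iξA`)] -/
theorem norm_expI_smul_sub_expI_smul_le {ξ : ℝ} (hξ : 0 ≤ ξ) {X X' : Matrix n n ℂ} {r : ℝ} (hX : ‖X‖ ≤ r) (hX' : ‖X'‖ ≤ r) (hξr : 2 * (ξ * r) ≤ 1) :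
    ‖exp ((Complex.I * ξ : ℂ) • X) - exp ((Complex.I * ξ : ℂ) • X')‖ ≤ 2 * ξ * ‖X - X'‖ := by
  have h := norm_exp_sub_exp_le ((Complex.I * ξ : ℂ) • X) ((Complex.I * ξ : ℂ) • X')
  have h1 : ‖(Complex.I * ξ : ℂ) • X‖ ≤ ξ * r := norm_smul_le_of_le hξ hX
  have h2 : ‖(Complex.I * ξ : ℂ) • X'‖ ≤ ξ * r := norm_smul_le_of_le hξ hX'
  have hmax : max ‖(Complex.I * ξ : ℂ) • X‖ ‖(Complex.I * ξ : ℂ) • X'‖ ≤ 1 / 2 := (max_le h1 h2).trans (by linarith)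
  have hexp : Real.exp (max ‖(Complex.I * ξ : ℂ) • X‖ ‖(Complex.I * ξ : ℂ) • X'‖) ≤ 2 := by
    refine (Real.exp_le_exp.2 hmax).trans ?_
    have he : Real.exp (1 / 2) ^ 2 = Real.exp 1 := by rw [← Real.exp_nat_mul]; norm_num
    nlinarith [Real.exp_pos (1 / 2 : ℝ), Real.exp_one_lt_d9]
  have hdiff : ‖(Complex.I * ξ : ℂ) • X - (Complex.I * ξ : ℂ) • X'‖ = ξ * ‖X - X'‖ := by rw [← smul_sub, norm_smul, norm_I_mul_ofReal hξ]
  rw [hdiff] at h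
  calc _ ≤ ξ * ‖X - X'‖ * Real.exp (max ‖(Complex.I * ξ : ℂ) • X‖ ‖(Complex.I * ξ : ℂ) • X'‖) := h
    _ ≤ ξ * ‖X - X'‖ * 2 := mul_le_mul_of_nonneg_left hexp (mul_nonneg hξ (norm_nonneg _))
    _ = 2 * ξ * ‖X - X'‖ := by ring

end Chart

/-! ## §2 The potential remainder in `A`-letters: C⁰ and C¹ -/

section Remainder

/-- **THE POTENTIAL REMAINDER IN `A`-LETTERS**: `P̃_c(A) := log Ū(c) − iξ·(Q₁A)(c) = P_c(U) + (Q₁E)(c)` with `E_b = U_b − 1 − iξA_b` the chart remainder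
(`linAvg_sub`, `Prop8Chart.linAvg_const_smul`). [cite: Balaban1985Averaging, Prop. 3 (121)-(125) p.36] -/
theorem potRemA_eq (U : GaugeField P j (Matrix.specialUnitaryGroup n ℂ)) (A : PBond P j → Matrix n n ℂ) (ξ : ℝ) (c : PBond P (j + 1)) :
    mlog (((avgFun (expMeanLogSU (n := n)) U c : Matrix.specialUnitaryGroup n ℂ) : Matrix n n ℂ)) - (Complex.I * ξ : ℂ) • linAvg A c =
      (mlog (((avgFun (expMeanLogSU (n := n)) U c : Matrix.specialUnitaryGroup n ℂ) : Matrix n n ℂ)) -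
          linAvg (fun b => ((U b : Matrix.specialUnitaryGroup n ℂ) : Matrix n n ℂ) - 1) c) +
        linAvg (fun b => ((U b : Matrix.specialUnitaryGroup n ℂ) : Matrix n n ℂ) - 1 - (Complex.I * ξ : ℂ) • A b) c := by
  rw [linAvg_sub (fun b => ((U b : Matrix.specialUnitaryGroup n ℂ) : Matrix n n ℂ) - 1) (fun b => (Complex.I * ξ : ℂ) • A b) c, linAvg_const_smul]
  abel

/-- ★ **PROP. 3 (123) IN `A`-LETTERS, C⁰**: for `U_b = exp(iξA_b)`, `‖A_b‖ ≤ r`, `48ℓξr ≤ 1`, `4ℓξr < δ_N`: `‖log Ū(c) − iξ·(Q₁A)(c)‖ ≤ 607·ℓ²ξ²r²`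
(file 1's `151(ℓδ)²` at `δ = 2ξr` plus `‖Q₁E‖ ≤ 3ℓ(ξr)²`) — print's `|C(V₀, A, c)| ≤ C₁L²|A|²` at `V₀ = 1`, single bar, with the tree's constant.
[cite: Balaban1985Averaging, Prop. 3 (121)-(123) p.36; Balaban1987RG1, (0.4) p.253 and (1.12) p.262] -/
theorem norm_potRemA_le (U : GaugeField P j (Matrix.specialUnitaryGroup n ℂ)) (A : PBond P j → Matrix n n ℂ) {ξ r : ℝ} (hξ : 0 ≤ ξ) (hr : 0 ≤ r)
    (hUA : ∀ b, ((U b : Matrix.specialUnitaryGroup n ℂ) : Matrix n n ℂ) = exp ((Complex.I * ξ : ℂ) • A b)) (hA : ∀ b, ‖A b‖ ≤ r)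
    (h48 : 48 * ((((P.d + 2) * P.L : ℕ) : ℝ) * (ξ * r)) ≤ 1) (hN : 4 * ((((P.d + 2) * P.L : ℕ) : ℝ) * (ξ * r)) < deltaSU n) (c : PBond P (j + 1)) :
    ‖mlog (((avgFun (expMeanLogSU (n := n)) U c : Matrix.specialUnitaryGroup n ℂ) : Matrix n n ℂ)) - (Complex.I * ξ : ℂ) • linAvg A c‖ ≤
      607 * (((P.d + 2) * P.L : ℕ) : ℝ) ^ 2 * ξ ^ 2 * r ^ 2 := by
  set ℓ : ℝ := (((P.d + 2) * P.L : ℕ) : ℝ) with hℓ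
  have hℓ1 : 1 ≤ ℓ := by
    rw [hℓ]; exact_mod_cast Nat.one_le_iff_ne_zero.mpr (Nat.mul_ne_zero (by omega) P.L_pos.ne')
  have hℓ0 : 0 ≤ ℓ := by linarith
  have hξr0 : 0 ≤ ξ * r := mul_nonneg hξ hr
  have hξr1 : ξ * r ≤ 1 := by nlinarith
  -- the chart letters
  have hU : ∀ b, ‖((U b : Matrix.specialUnitaryGroup n ℂ) : Matrix n n ℂ) - 1‖ ≤ 2 * (ξ * r) := fun b => by
    rw [hUA]; exact norm_expI_smul_sub_one_le hξ (hA b) hξr1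
  have hE : ∀ b, ‖((U b : Matrix.specialUnitaryGroup n ℂ) : Matrix n n ℂ) - 1 - (Complex.I * ξ : ℂ) • A b‖ ≤ (ξ * r) ^ 2 := fun b => by
    rw [hUA]; exact norm_expI_smul_sub_one_sub_le hξ (hA b) hξr1
  have h24 : 24 * (ℓ * (2 * (ξ * r))) ≤ 1 := by linarith
  have hN' : 2 * (ℓ * (2 * (ξ * r))) < deltaSU n := by linarith
  have hP := norm_mlog_avgFun_sub_linAvg_le U (by positivity) hU h24 hN' c
  have hQE := norm_linAvg_le (fun b => ((U b : Matrix.specialUnitaryGroup n ℂ) : Matrix n n ℂ) - 1 - (Complex.I * ξ : ℂ) • A b) (sq_nonneg _) hE c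
  rw [potRemA_eq]
  calc _ ≤ _ := norm_add_le _ _
    _ ≤ 151 * (ℓ * (2 * (ξ * r))) ^ 2 + 3 * ℓ * (ξ * r) ^ 2 := add_le_add hP hQE
    _ = (604 * ℓ ^ 2 + 3 * ℓ) * (ξ * r) ^ 2 := by ring
    _ ≤ (607 * ℓ ^ 2) * (ξ * r) ^ 2 := by
        have : 3 * ℓ ≤ 3 * ℓ ^ 2 := by nlinarith
        exact mul_le_mul_of_nonneg_right (by linarith) (sq_nonneg _)
    _ = 607 * ℓ ^ 2 * ξ ^ 2 * r ^ 2 := by ring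

/-- ★ **PROP. 3 IN `A`-LETTERS, C¹: THE POTENTIAL REMAINDER IS LIPSCHITZ IN THE FINE POTENTIAL WITH THE SMALLNESS FACTOR**: for `U_b = exp(iξA_b)`, `U′_b = exp(iξA′_b)`,
`‖A_b‖, ‖A′_b‖ ≤ r`, `‖A_b − A′_b‖ ≤ ρ` (`48ℓξr ≤ 1`, `4ℓξr < δ_N`): `‖P̃_c(A) − P̃_c(A′)‖ ≤ 1166·ℓ²ξ²r·ρ` — file 1's `290ℓ²δε` at `δ = 2ξr`, `ε = 2ξρ`, plus module 27's
`‖Q₁(E − E′)‖ ≤ 3ℓ·2ξ²rρ`. [cite: Balaban1985Averaging, Prop. 3 (121)-(123) p.36; Balaban1987RG1, (1.12) p.262] -/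
theorem norm_potRemA_sub_potRemA_le (U U' : GaugeField P j (Matrix.specialUnitaryGroup n ℂ)) (A A' : PBond P j → Matrix n n ℂ) {ξ r ρ : ℝ} (hξ : 0 ≤ ξ)
    (hr : 0 ≤ r) (hρ : 0 ≤ ρ)
    (hUA : ∀ b, ((U b : Matrix.specialUnitaryGroup n ℂ) : Matrix n n ℂ) = exp ((Complex.I * ξ : ℂ) • A b))
    (hUA' : ∀ b, ((U' b : Matrix.specialUnitaryGroup n ℂ) : Matrix n n ℂ) = exp ((Complex.I * ξ : ℂ) • A' b))
    (hA : ∀ b, ‖A b‖ ≤ r) (hA' : ∀ b, ‖A' b‖ ≤ r) (hAA' : ∀ b, ‖A b - A' b‖ ≤ ρ)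
    (h48 : 48 * ((((P.d + 2) * P.L : ℕ) : ℝ) * (ξ * r)) ≤ 1) (hN : 4 * ((((P.d + 2) * P.L : ℕ) : ℝ) * (ξ * r)) < deltaSU n) (c : PBond P (j + 1)) :
    ‖(mlog (((avgFun (expMeanLogSU (n := n)) U c : Matrix.specialUnitaryGroup n ℂ) : Matrix n n ℂ)) - (Complex.I * ξ : ℂ) • linAvg A c) -
        (mlog (((avgFun (expMeanLogSU (n := n)) U' c : Matrix.specialUnitaryGroup n ℂ) : Matrix n n ℂ)) - (Complex.I * ξ : ℂ) • linAvg A' c)‖ ≤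
      1166 * (((P.d + 2) * P.L : ℕ) : ℝ) ^ 2 * ξ ^ 2 * r * ρ := by
  set ℓ : ℝ := (((P.d + 2) * P.L : ℕ) : ℝ) with hℓ
  have hℓ1 : 1 ≤ ℓ := by
    rw [hℓ]; exact_mod_cast Nat.one_le_iff_ne_zero.mpr (Nat.mul_ne_zero (by omega) P.L_pos.ne')
  have hℓ0 : 0 ≤ ℓ := by linarith
  have hξr0 : 0 ≤ ξ * r := mul_nonneg hξ hr
  have hξr1 : ξ * r ≤ 1 := by nlinarith
  have hξr2 : 2 * (ξ * r) ≤ 1 := by nlinarith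
  -- the chart letters for both configurations
  have hU : ∀ b, ‖((U b : Matrix.specialUnitaryGroup n ℂ) : Matrix n n ℂ) - 1‖ ≤ 2 * (ξ * r) := fun b => by
    rw [hUA]; exact norm_expI_smul_sub_one_le hξ (hA b) hξr1
  have hU' : ∀ b, ‖((U' b : Matrix.specialUnitaryGroup n ℂ) : Matrix n n ℂ) - 1‖ ≤ 2 * (ξ * r) := fun b => by
    rw [hUA']; exact norm_expI_smul_sub_one_le hξ (hA' b) hξr1
  have hUU' : ∀ b, ‖((U b : Matrix.specialUnitaryGroup n ℂ) : Matrix n n ℂ) - ((U' b : Matrix.specialUnitaryGroup n ℂ) : Matrix n n ℂ)‖ ≤ 2 * ξ * ρ :=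
    fun b => by
      rw [hUA, hUA']
      exact (norm_expI_smul_sub_expI_smul_le hξ (hA b) (hA' b) hξr2).trans (mul_le_mul_of_nonneg_left (hAA' b) (by positivity))
  have hEE' : ∀ b, ‖(((U b : Matrix.specialUnitaryGroup n ℂ) : Matrix n n ℂ) - 1 - (Complex.I * ξ : ℂ) • A b) -
      (((U' b : Matrix.specialUnitaryGroup n ℂ) : Matrix n n ℂ) - 1 - (Complex.I * ξ : ℂ) • A' b)‖ ≤ 2 * ξ ^ 2 * r * ρ := fun b => by
    rw [hUA, hUA']
    exact (norm_expRem_smul_sub_le_linear hξ hr hξr1 (hA b) (hA' b)).trans (mul_le_mul_of_nonneg_left (hAA' b) (by positivity))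
  have h24 : 24 * (ℓ * (2 * (ξ * r))) ≤ 1 := by linarith
  have hN' : 2 * (ℓ * (2 * (ξ * r))) < deltaSU n := by linarith
  -- file 1's C¹ bound and the linear term of the chart remainders
  have hP := norm_potRem_sub_potRem_le U U' (by positivity) (by positivity) hU hU' hUU' h24 hN' c
  have hQ : ‖linAvg (fun b => ((U b : Matrix.specialUnitaryGroup n ℂ) : Matrix n n ℂ) - 1 - (Complex.I * ξ : ℂ) • A b) c -
      linAvg (fun b => ((U' b : Matrix.specialUnitaryGroup n ℂ) : Matrix n n ℂ) - 1 - (Complex.I * ξ : ℂ) • A' b) c‖ ≤ 3 * ℓ * (2 * ξ ^ 2 * r * ρ) := by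
    rw [← linAvg_sub]
    exact norm_linAvg_le _ (by positivity) (fun b => hEE' b) c
  rw [potRemA_eq, potRemA_eq]
  have e : ∀ (a b a' b' : Matrix n n ℂ), (a + b) - (a' + b') = (a - a') + (b - b') := fun a b a' b' => by abel
  rw [e]
  calc _ ≤ _ := norm_add_le _ _
    _ ≤ 290 * ℓ ^ 2 * (2 * (ξ * r)) * (2 * ξ * ρ) + 3 * ℓ * (2 * ξ ^ 2 * r * ρ) := add_le_add hP hQ
    _ = (1160 * ℓ ^ 2 + 6 * ℓ) * (ξ ^ 2 * r * ρ) := by ring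
    _ ≤ (1166 * ℓ ^ 2) * (ξ ^ 2 * r * ρ) := by
        have : 6 * ℓ ≤ 6 * ℓ ^ 2 := by nlinarith
        exact mul_le_mul_of_nonneg_right (by linarith) (by positivity)
    _ = 1166 * ℓ ^ 2 * ξ ^ 2 * r * ρ := by ring

end Remainder

/-! ## §3 Coarse unit differences of the potential remainder in `A`-letters -/

section CoarseDiff

omit [Fintype n] [DecidableEq n] [Nonempty n] in
/-- Translating a bond by the unit vector `e_ν` shifts its source (`Site.add_zero_shift`). [folklore] -/
private theorem translate_zero_shift' {i : ℕ} (b : PBond P i) (ν : Fin P.d) : b.translate ((0 : Site P i).shift ν) = ⟨b.src.shift ν, b.dir⟩ := by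
  cases b; simp only [PBond.translate, Site.add_zero_shift]

/-- `scale e_ν = L • e_ν` one level down (public twin `B13AvgCorrKappaOneLetters.scale_zero_shift` in the T⁴ `Support` tree, not imported; kept private). [folklore] -/
private theorem scale_zero_shift' (ν : Fin P.d) : Site.scale ((0 : Site P (j + 1)).shift ν) = P.L • (0 : Site P j).shift ν := by
  funext κ
  show Site.scaleCoord P j (((0 : Site P (j + 1)).shift ν) κ) = P.L • (((0 : Site P j).shift ν) κ)
  by_cases h : κ = ν
  · have h1 : ((0 : Site P (j + 1)).shift ν) κ = 1 := by rw [Site.shift_apply, if_pos h, Site.zero_apply, zero_add]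
    have h2 : ((0 : Site P j).shift ν) κ = 1 := by rw [Site.shift_apply, if_pos h, Site.zero_apply, zero_add]
    rw [h1, h2, Site.scaleCoord_one, nsmul_eq_mul, mul_one]
  · have h1 : ((0 : Site P (j + 1)).shift ν) κ = 0 := by rw [Site.shift_apply, if_neg h, Site.zero_apply]
    have h2 : ((0 : Site P j).shift ν) κ = 0 := by rw [Site.shift_apply, if_neg h, Site.zero_apply]
    rw [h1, h2, map_zero, smul_zero]

omit [Fintype n] [DecidableEq n] [Nonempty n] in
/-- The linearised average of the unit-translated potential is the linearised average at the shifted bond (module 26's `linAvg_translate` at `a = e_ν`,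
`scale e_ν = L·e_ν`). [cite: Balaban1985Averaging, (124)-(125) p.36] -/
theorem linAvg_translate_shift (A : PBond P j → Matrix n n ℂ) (y : Site P (j + 1)) (μ ν : Fin P.d) :
    linAvg (fun b => A (b.translate (P.L • (0 : Site P j).shift ν))) ⟨y, μ⟩ = linAvg A ⟨y.shift ν, μ⟩ := by
  have h := YMDAG.N18.HolonomyLipschitz.linAvg_translate ((0 : Site P (j + 1)).shift ν) A ⟨y, μ⟩
  rw [translate_zero_shift', scale_zero_shift'] at h
  exact h

/-- ★ **COARSE UNIT DIFFERENCES OF THE POTENTIAL REMAINDER IN `A`-LETTERS ARE SECOND ORDER**: for `U_b = exp(iξA_b)`, `‖A_b‖ ≤ r`, with `r₁` a bound on the fine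
unit `ν`-differences `‖A(b + e_ν) − A(b)‖` (`48ℓξr ≤ 1`, `4ℓξr < δ_N`):
`‖P̃_{⟨y + e_ν, μ⟩}(A) − P̃_{⟨y, μ⟩}(A)‖ ≤ 1166·ℓ²ξ²r·(L·r₁)` — §2 at the pair `(A ∘ τ_{Le_ν}, A)` (telescoped: `‖A(b + Le_ν) − A(b)‖ ≤ L·r₁`) and translation
covariance. [cite: Balaban1987RG1, (1.12) p.262 and (2.17) p.269; Balaban1985Averaging, Prop. 3 (121)-(123) p.36] -/
theorem norm_potRemA_shift_sub_le (U : GaugeField P j (Matrix.specialUnitaryGroup n ℂ)) (A : PBond P j → Matrix n n ℂ) (y : Site P (j + 1)) (μ ν : Fin P.d)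
    {ξ r r₁ : ℝ} (hξ : 0 ≤ ξ) (hr : 0 ≤ r) (hr₁ : 0 ≤ r₁)
    (hUA : ∀ b, ((U b : Matrix.specialUnitaryGroup n ℂ) : Matrix n n ℂ) = exp ((Complex.I * ξ : ℂ) • A b)) (hA : ∀ b, ‖A b‖ ≤ r)
    (hA₁ : ∀ b : PBond P j, ‖A ⟨b.src.shift ν, b.dir⟩ - A b‖ ≤ r₁)
    (h48 : 48 * ((((P.d + 2) * P.L : ℕ) : ℝ) * (ξ * r)) ≤ 1) (hN : 4 * ((((P.d + 2) * P.L : ℕ) : ℝ) * (ξ * r)) < deltaSU n) :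
    ‖(mlog (((avgFun (expMeanLogSU (n := n)) U ⟨y.shift ν, μ⟩ : Matrix.specialUnitaryGroup n ℂ) : Matrix n n ℂ)) - (Complex.I * ξ : ℂ) • linAvg A ⟨y.shift ν, μ⟩) -
        (mlog (((avgFun (expMeanLogSU (n := n)) U ⟨y, μ⟩ : Matrix.specialUnitaryGroup n ℂ) : Matrix n n ℂ)) - (Complex.I * ξ : ℂ) • linAvg A ⟨y, μ⟩)‖ ≤
      1166 * (((P.d + 2) * P.L : ℕ) : ℝ) ^ 2 * ξ ^ 2 * r * (P.L * r₁) := by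
  -- the translated pair
  set a : Site P j := P.L • (0 : Site P j).shift ν with ha
  set U' : GaugeField P j (Matrix.specialUnitaryGroup n ℂ) := U.translate a with hU'
  set A' : PBond P j → Matrix n n ℂ := fun b => A (b.translate a) with hA'
  have hUA' : ∀ b, ((U' b : Matrix.specialUnitaryGroup n ℂ) : Matrix n n ℂ) = exp ((Complex.I * ξ : ℂ) • A' b) := fun b => by
    rw [hU', GaugeField.translate_apply, hUA]
  have hA'r : ∀ b, ‖A' b‖ ≤ r := fun b => hA _
  -- telescoping the unit differences of `A` (an additive-group copy of module 26's `norm_translate_nsmul_sub_le`)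
  have htel : ∀ (m : ℕ) (b : PBond P j), ‖A (b.translate (m • (0 : Site P j).shift ν)) - A b‖ ≤ m * r₁ := by
    intro m
    induction m with
    | zero =>
      intro b
      have h0 : b.translate ((0 : ℕ) • (0 : Site P j).shift ν) = b := by cases b; simp [PBond.translate]
      rw [h0, sub_self, norm_zero, Nat.cast_zero, zero_mul]
    | succ m ih =>
      intro b
      have hs : b.translate ((m + 1) • (0 : Site P j).shift ν) = (b.translate (m • (0 : Site P j).shift ν)).translate ((0 : Site P j).shift ν) := by
        rw [PBond.translate_translate, succ_nsmul]
      rw [hs]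
      have h1 := hA₁ (b.translate (m • (0 : Site P j).shift ν))
      rw [← translate_zero_shift'] at h1
      calc _ ≤ ‖A ((b.translate (m • (0 : Site P j).shift ν)).translate ((0 : Site P j).shift ν)) - A (b.translate (m • (0 : Site P j).shift ν))‖ +
              ‖A (b.translate (m • (0 : Site P j).shift ν)) - A b‖ := norm_sub_le_norm_sub_add_norm_sub _ _ _
        _ ≤ r₁ + m * r₁ := add_le_add h1 (ih b)
        _ = ((m + 1 : ℕ) : ℝ) * r₁ := by push_cast; ring
  have hAA' : ∀ b, ‖A' b - A b‖ ≤ P.L * r₁ := fun b => by rw [hA']; exact htel P.L b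
  -- the averaged potential and the linear term at the shifted bond are those of the translated pair at the unshifted bond
  have havg : mlog (((avgFun (expMeanLogSU (n := n)) U ⟨y.shift ν, μ⟩ : Matrix.specialUnitaryGroup n ℂ) : Matrix n n ℂ)) =
      mlog (((avgFun (expMeanLogSU (n := n)) U' ⟨y, μ⟩ : Matrix.specialUnitaryGroup n ℂ) : Matrix n n ℂ)) := by
    have h := mlog_avgFun_translate ((0 : Site P (j + 1)).shift ν) U (⟨y, μ⟩ : PBond P (j + 1))
    rw [translate_zero_shift', scale_zero_shift'] at h
    rw [hU', ha, ← h]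
  have hlin : linAvg A ⟨y.shift ν, μ⟩ = linAvg A' ⟨y, μ⟩ := by rw [hA', ha, linAvg_translate_shift]
  rw [havg, hlin]
  have h := norm_potRemA_sub_potRemA_le U' U A' A hξ hr (mul_nonneg (Nat.cast_nonneg _) hr₁) hUA' hUA hA'r hA hAA' h48 hN ⟨y, μ⟩
  exact h

end CoarseDiff

/-! ## §4 The (1.12) letters of the comb-corrected averaged potential in `A`-letters -/

section Letters

/-- ★ **THE AVERAGED POTENTIAL IN `A`-LETTERS, MAIN TERM IDENTIFIED**: `log Ū(c) + iξ·(λ̄_A(c₊) − λ̄_A(c₋)) = (iξL)·(QA)(c) + P̃_c(A)` — the main term is `ξ′ = Lξ` times the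
straight block average OF RECORD of the fine potential, the comb term is the linearised coarse gauge (`linAvg_eq_bondAvg_sub_grad_combMean`).
[cite: Balaban1985Averaging, (62) p.28 and (124)-(125) p.36; Balaban1987RG1, (1.12) p.262] -/
theorem mlog_avgFun_add_smul_grad_combMean_eq (U : GaugeField P j (Matrix.specialUnitaryGroup n ℂ)) (A : PBond P j → Matrix n n ℂ) (ξ : ℝ) (c : PBond P (j + 1)) :
    mlog (((avgFun (expMeanLogSU (n := n)) U c : Matrix.specialUnitaryGroup n ℂ) : Matrix n n ℂ)) + (Complex.I * ξ : ℂ) • (combMean A c.tgt - combMean A c.src) =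
      (Complex.I * ξ * P.L : ℂ) • bondAvg A c +
        (mlog (((avgFun (expMeanLogSU (n := n)) U c : Matrix.specialUnitaryGroup n ℂ) : Matrix n n ℂ)) - (Complex.I * ξ : ℂ) • linAvg A c) := by
  rw [linAvg_eq_bondAvg_sub_grad_combMean]
  simp only [smul_sub, smul_smul]
  abel

/-- ★ **THE SUP LETTER IN `A`-LETTERS**: `U_b = exp(iξA_b)`, `‖A_b‖ ≤ r` everywhere and `≤ a` on the `L^{d+1}` FEEDING bonds of `c` (`48ℓξr ≤ 1`, `4ℓξr < δ_N`):
`‖log Ū(c) + iξ(λ̄_A(c₊) − λ̄_A(c₋))‖ ≤ (Lξ)·a + 607·ℓ²ξ²r²` — dividing by `ξ′ = Lξ`: `|Ā + dλ̄_A∕L|(c) ≤ |A|_feed + 607(d+2)²·L·ξ·r²`, print's `|Ā| ≤ |A|(1 + O(ℓ²ξα₀))`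
before the comb gauge (King's (K-a), dag-n18-d 19a). [cite: Balaban1987RG1, (1.12) p.262; Balaban1985Averaging, Prop. 3 (123) p.36] -/
theorem norm_mlog_avgFun_add_smul_grad_combMean_le (U : GaugeField P j (Matrix.specialUnitaryGroup n ℂ)) (A : PBond P j → Matrix n n ℂ) (c : PBond P (j + 1))
    {ξ r a : ℝ} (hξ : 0 ≤ ξ) (hr : 0 ≤ r)
    (hUA : ∀ b, ((U b : Matrix.specialUnitaryGroup n ℂ) : Matrix n n ℂ) = exp ((Complex.I * ξ : ℂ) • A b)) (hA : ∀ b, ‖A b‖ ≤ r)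
    (ha : ∀ ρ : Fin P.d → Fin P.L, ∀ t < P.L, ‖A (runBond (Site.blockSite c.src ρ) c.dir t)‖ ≤ a)
    (h48 : 48 * ((((P.d + 2) * P.L : ℕ) : ℝ) * (ξ * r)) ≤ 1) (hN : 4 * ((((P.d + 2) * P.L : ℕ) : ℝ) * (ξ * r)) < deltaSU n) :
    ‖mlog (((avgFun (expMeanLogSU (n := n)) U c : Matrix.specialUnitaryGroup n ℂ) : Matrix n n ℂ)) + (Complex.I * ξ : ℂ) • (combMean A c.tgt - combMean A c.src)‖ ≤
      P.L * ξ * a + 607 * (((P.d + 2) * P.L : ℕ) : ℝ) ^ 2 * ξ ^ 2 * r ^ 2 := by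
  rw [mlog_avgFun_add_smul_grad_combMean_eq]
  have hQ : ‖bondAvg A c‖ ≤ a := norm_bondAvg_le_of_forall_run (V := Matrix n n ℂ) _ c ha
  have hP := norm_potRemA_le U A hξ hr hUA hA h48 hN c
  have hL : ‖(Complex.I * ξ * P.L : ℂ) • bondAvg A c‖ ≤ P.L * ξ * a := by
    rw [norm_smul, norm_mul, norm_mul, Complex.norm_I, one_mul, Complex.norm_real, Real.norm_of_nonneg hξ, Complex.norm_natCast]
    calc ξ * P.L * ‖bondAvg A c‖ ≤ ξ * P.L * a := mul_le_mul_of_nonneg_left hQ (by positivity)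
      _ = P.L * ξ * a := by ring
  exact (norm_add_le _ _).trans (add_le_add hL hP)

/-- ★ **THE COARSE-DIFFERENCE LETTER IN `A`-LETTERS** (standing range `j + 1 ≤ m + K`): `U_b = exp(iξA_b)`, `‖A_b‖ ≤ r`, unit `ν`-differences `‖A(b + e_ν) − A(b)‖ ≤ r₁`
(`48ℓξr ≤ 1`, `4ℓξr < δ_N`); for `c = ⟨y, μ⟩`, `c′ = ⟨y + e_ν, μ⟩`:
`‖[log Ū + iξ·dλ̄_A](c′) − [log Ū + iξ·dλ̄_A](c)‖ ≤ (Lξ)·(L·r₁) + 1166·ℓ²ξ²r·(L·r₁)` — dividing by `ξ′ = Lξ` and by the coarse spacing, `|∇^{ξ′}_ν(Ā + dλ̄_A∕L)| ≤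
sup|∇^ξ_ν A|·(1 + 1166·(d+2)²·L·ξr)`: King's EXACT (K-b) plus a relative slack `O(d²L·ξ·α₀)`, summable in the scale — print's `|∇^ξ Ā| < O(1)LMBα₀` transport, single bar.
[cite: Balaban1987RG1, (1.12) p.262; Balaban1985Averaging, Prop. 3 (123) p.36] -/
theorem norm_shift_sub_mlog_avgFun_add_smul_grad_combMean_le (hj : j + 1 ≤ P.m + P.K) (U : GaugeField P j (Matrix.specialUnitaryGroup n ℂ))
    (A : PBond P j → Matrix n n ℂ) (y : Site P (j + 1)) (μ ν : Fin P.d) {ξ r r₁ : ℝ} (hξ : 0 ≤ ξ) (hr : 0 ≤ r) (hr₁ : 0 ≤ r₁)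
    (hUA : ∀ b, ((U b : Matrix.specialUnitaryGroup n ℂ) : Matrix n n ℂ) = exp ((Complex.I * ξ : ℂ) • A b)) (hA : ∀ b, ‖A b‖ ≤ r)
    (hA₁ : ∀ b : PBond P j, ‖A ⟨b.src.shift ν, b.dir⟩ - A b‖ ≤ r₁)
    (h48 : 48 * ((((P.d + 2) * P.L : ℕ) : ℝ) * (ξ * r)) ≤ 1) (hN : 4 * ((((P.d + 2) * P.L : ℕ) : ℝ) * (ξ * r)) < deltaSU n) :
    ‖(mlog (((avgFun (expMeanLogSU (n := n)) U ⟨y.shift ν, μ⟩ : Matrix.specialUnitaryGroup n ℂ) : Matrix n n ℂ)) +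
          (Complex.I * ξ : ℂ) • (combMean A (⟨y.shift ν, μ⟩ : PBond P (j + 1)).tgt - combMean A (y.shift ν))) -
        (mlog (((avgFun (expMeanLogSU (n := n)) U ⟨y, μ⟩ : Matrix.specialUnitaryGroup n ℂ) : Matrix n n ℂ)) +
          (Complex.I * ξ : ℂ) • (combMean A (⟨y, μ⟩ : PBond P (j + 1)).tgt - combMean A y))‖ ≤
      P.L * ξ * (P.L * r₁) + 1166 * (((P.d + 2) * P.L : ℕ) : ℝ) ^ 2 * ξ ^ 2 * r * (P.L * r₁) := by
  have e1 := mlog_avgFun_add_smul_grad_combMean_eq U A ξ (⟨y.shift ν, μ⟩ : PBond P (j + 1))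
  have e0 := mlog_avgFun_add_smul_grad_combMean_eq U A ξ (⟨y, μ⟩ : PBond P (j + 1))
  rw [show (⟨y.shift ν, μ⟩ : PBond P (j + 1)).src = y.shift ν from rfl] at e1
  rw [show (⟨y, μ⟩ : PBond P (j + 1)).src = y from rfl] at e0
  rw [e1, e0]
  have hKb : ‖bondAvg A ⟨y.shift ν, μ⟩ - bondAvg A ⟨y, μ⟩‖ ≤ P.L * r₁ :=
    norm_bondAvg_shift_sub_le_of_forall_run (V := Matrix n n ℂ) hj A y μ ν fun ρ t _ s _ => hA₁ ⟨runSite (runSite (Site.blockSite y ρ) μ t) ν s, μ⟩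
  have hP := norm_potRemA_shift_sub_le U A y μ ν hξ hr hr₁ hUA hA hA₁ h48 hN
  have e : (Complex.I * ξ * P.L : ℂ) • bondAvg A ⟨y.shift ν, μ⟩ +
        (mlog (((avgFun (expMeanLogSU (n := n)) U ⟨y.shift ν, μ⟩ : Matrix.specialUnitaryGroup n ℂ) : Matrix n n ℂ)) - (Complex.I * ξ : ℂ) • linAvg A ⟨y.shift ν, μ⟩) -
      ((Complex.I * ξ * P.L : ℂ) • bondAvg A ⟨y, μ⟩ +
        (mlog (((avgFun (expMeanLogSU (n := n)) U ⟨y, μ⟩ : Matrix.specialUnitaryGroup n ℂ) : Matrix n n ℂ)) - (Complex.I * ξ : ℂ) • linAvg A ⟨y, μ⟩)) =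
      (Complex.I * ξ * P.L : ℂ) • (bondAvg A ⟨y.shift ν, μ⟩ - bondAvg A ⟨y, μ⟩) +
        ((mlog (((avgFun (expMeanLogSU (n := n)) U ⟨y.shift ν, μ⟩ : Matrix.specialUnitaryGroup n ℂ) : Matrix n n ℂ)) - (Complex.I * ξ : ℂ) • linAvg A ⟨y.shift ν, μ⟩) -
          (mlog (((avgFun (expMeanLogSU (n := n)) U ⟨y, μ⟩ : Matrix.specialUnitaryGroup n ℂ) : Matrix n n ℂ)) - (Complex.I * ξ : ℂ) • linAvg A ⟨y, μ⟩)) := by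
    rw [smul_sub]; abel
  rw [e]
  have hL : ‖(Complex.I * ξ * P.L : ℂ) • (bondAvg A ⟨y.shift ν, μ⟩ - bondAvg A ⟨y, μ⟩)‖ ≤ P.L * ξ * (P.L * r₁) := by
    rw [norm_smul, norm_mul, norm_mul, Complex.norm_I, one_mul, Complex.norm_real, Real.norm_of_nonneg hξ, Complex.norm_natCast]
    calc ξ * P.L * ‖bondAvg A ⟨y.shift ν, μ⟩ - bondAvg A ⟨y, μ⟩‖ ≤ ξ * P.L * (P.L * r₁) := mul_le_mul_of_nonneg_left hKb (by positivity)
      _ = P.L * ξ * (P.L * r₁) := by ring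
  exact (norm_add_le _ _).trans (add_le_add hL hP)

end Letters

end YMDAG.N18.AvgPotential
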